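import Summits.QuantumFields.YangMills.Theses.ScalingWindowSplit

/-!
# Birth skeleton (BC3) for crux `SelfNormalisedSkewnessGapped` (stmt-QuantumFields-18170) — `Lines/birth.lean`

Registrar: `planner-skel-stmt-QuantumFields-18170-0` (skeleton-register one-shot; route
`route-QuantumFields-ScalingWindowSplit`, sub-problem `YangMills`, re-audit bin HONEST), 2026-08-17.

Crux W₂ᴳ (route file `Theses/ScalingWindowSplit.lean`, decl
`Summit.QuantumFields.YangMills.Theses.ScalingWindowSplit.SelfNormalisedSkewnessGapped`, rank 5; the
refuter's repair C′ of the refuted-misstated W₂ `SelfNormalisedSkewness`, stmt-18944): for every compact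
`G`, faithful `r`, scheme `sch` at weak coupling, past-supported bump `u`, `p`, `M` and `Δ > 0` WITH the
volume-uniform lattice gap `HasLatticeMassGap r sch Δ`, polynomial volumes, and eventually the floor
`a_k^p ≤ T⁰_k(u,θu)` and the window `T⁰_k(u,θu) ≤ M·T⁰_k(τ₋₁u,θτ₋₁u)` of the BARE truncated plaquette
two-point function, there are pairwise disjointly supported tests `f, g, h` and `δ > 0` with eventually
`δ ≤ |κ₃^canon_k(f,g,h)|` — the third cumulant of the SELF-NORMALISED curvature field (`c'_k = 1/√T⁰_k(u,θu)`,
`m'_k = ⟨action density⟩_k`).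

## The cut: SEAM ⊕ CEILING ⊕ SLAB RESPONSE (mirror geometry), glued by square-root arithmetic

The self-normalised skewness is the ratio `κ₃⁰ / (T⁰)^{3/2}` of two BARE lattice quantities.  Every
mechanism proposed for W₂ᴳ (crux ideas `hellmann-feynman-slab`, `running-gap-sum-rule`,
`trace-anomaly-ope` on stmt-18944, typed against C′) produces the bare third cumulant with ONE extra
insertion of the dimension-4 curvature field, i.e. a lower bound of the shape `κ₃⁰ ≳ a_k⁴ · T⁰`, and the
passage to the ratio then costs exactly the canonical-dimension CEILING `T⁰ ≲ a_k⁸` (the `hellmann-feynman-slab`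
card's "hidden stub C5 of the repaired crux as such").  The skeleton cuts along these three seams and
commits the triple to the MIRROR geometry `(f, g, h) = (τ₋₁u, g_slab, θτ₋₁u)` — the two legs are the
window pair the hypotheses are built on, the middle leg sits in the slab `|x⁰| < 1` around the reflection
plane (pairwise disjoint for EVERY past-supported `u`, proved below) — where reflection positivity makes
`κ₃` a diagonal matrix element and Feynman–Hellmann reads it as the coupling-response of the window
correlator (2 of the 3 crux ideas live in this geometry; `trace-anomaly-ope` would replace stub 3 only).

* `stub_skewSeam` — **order-3 seam identity** (provable now, size M): affine renormalisation
  `Φ ↦ c'(Φ⁰ − m'·𝟙)` multiplies the third cumulant by `c'³` and the deterministic shift drops out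
  (probability measure): `κ₃^canon_k(f,g,h) = (√T⁰_k(u,θu))⁻¹ ^ 3 · κ₃⁰_k(f,g,h)` for ALL `f, g, h, k`
  (also when `T⁰ ≤ 0`, where both sides vanish: `(√T)⁻¹ = 0`).  The order-2 analogue is the landed
  `cov_affine` / `trunc_rescale` of `Theorems/ScalingWindowSplitExistenceLegFromLattice`.
* `stub_twoPointCeiling` — **UV ceiling of canonical-dimension type** (size L, stability grade — the
  currency of crux U_R): under the crux hypotheses `∃ C, ∀ᶠ k, T⁰_k(u,θu) ≤ C · a_k⁸` (the bare action
  density is `a⁴ ×` a dimension-4 field; perturbatively `β⁻² a⁸ I(u)`, at one scale `Z² a⁸ ⟨θ(u)θ(θu)⟩`).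
  Dual to the floor `a_k^p ≤ T⁰`; with it the floor exponent is forced `p ≥ 8`.
* `stub_mirrorSlabResponse` — **the open core (IR, uses the GAP)**: under the crux hypotheses there are a
  slab test `g` (`tsupport g ⊆ {|x⁰| < 1}`) and `δ > 0` with eventually
  `δ · a_k⁴ · T⁰_k(u,θu) ≤ |κ₃⁰_k(τ₋₁u, g, θτ₋₁u)|` — one slab insertion of the action density between the
  window pair costs at least `δ a_k⁴` relative to the pair correlator.  Feynman–Hellmann / action sum rule
  (Michael1987): `κ₃⁰(Φ⁰(τ₋₁u), Φ⁰(1_slab), Φ⁰(θτ₋₁u)) ≈ a_k⁴ · (−∂_β E/a_k per layer × 1/a_k layers) ·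
  T⁰(τ₋₁u) = a_k⁴ · c_G m_phys · T⁰(τ₋₁u)` with `c_G = −∂_β log(a m) → 1/(4N b₀) > 0` (dimensional
  transmutation) and `T⁰(τ₋₁u) ≥ T⁰(u)/M` (window); the GAP `Δ ≤ m_phys` bounds the rate below and
  clustering (`HasLatticeMassGap`) localises the layer sums to a Schwartz `g`.  FALSE exactly where the
  gap-free W₂ died (super-weak `U(1)₄`: nothing runs, `κ₃⁰/(a⁴T⁰) = O(a_k/β_k) → 0`) — this stub is where
  the repair hypothesis `0 < Δ → HasLatticeMassGap r sch Δ` is consumed.  Open (transfer target C⁺ =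
  `GapRunsWithCoupling` of the `hellmann-feynman-slab` card); why it might fail: a φ⁴₄-type Gaussian
  one-scale limit (nothing runs at leading order), or sign changes of the slab response across the
  admissible band `m_phys ∈ [Δ, ½ log M]`.
* `SelfNormalisedSkewnessGapped_of : stub₁-sig → stub₂-sig → stub₃-sig → SelfNormalisedSkewnessGapped` —
  sorry-free: the FLOOR gives `T⁰ > 0` (honouring the landed negative lemma
  `Theorems.SelfNormalisedSkewnessGapped.Negative.selfNormalisedSkewnessGapped_false_without_floor`: the
  trivial group meets gap, ceiling (`0 ≤ C a⁸`), slab bound (`0 ≤ 0`) and seam, and is stopped HERE),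
  `|κ₃^canon| = (√T⁰)⁻³|κ₃⁰| ≥ (√T⁰)⁻³ δ a⁴ T⁰ = δ a⁴/√T⁰ ≥ δ/√(max C 1)` by the ceiling; disjointness of
  `(τ₋₁u, g, θτ₋₁u)` from `tsupport u ⊆ {x⁰ < 0}` (`tsupport τ₋₁u ⊆ {x⁰ < −1}`, `tsupport θτ₋₁u ⊆ {1 < x⁰}`).
  `SelfNormalisedSkewnessGapped_skeleton` instantiates it with the three stubs BY NAME.

`lean check`: rc 0; sorries = 3 = stubs, zero elsewhere; `#h21_check_skeleton` ok.  Namespace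
`Summit.QuantumFields.YangMills.Cruxes.SelfNormalisedSkewnessGapped.Birth`; stub statements `Sig.stub_<name>`
(generated together with the stub theorems from one source, registrar folder `gen/make_skeleton.py`).
-/

set_option autoImplicit false

noncomputable section

namespace Summit.QuantumFields.YangMills.Cruxes.SelfNormalisedSkewnessGapped.Birth

open scoped BigOperators Topology
open Filter Set MeasureTheory
open Literature.MathematicalPhysics.QuantumLattice Literature.MathematicalPhysics.AQFT
  Literature.MathematicalPhysics.QuantumFieldTheory

/-! ## § Vocabulary — the crux's `bare`, `T`, `canon` and `κ₃`, verbatim (definitional unfolding only) -/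

/-- Euclidean `ℝ⁴` (the crux's `let E := EuclideanSpace ℝ (Fin 4)`). [folklore] -/
abbrev E4 : Type := EuclideanSpace ℝ (Fin 4)

section Vocabulary

variable {G : Type} [Group G] [TopologicalSpace G] [IsTopologicalGroup G] [CompactSpace G]
  [MeasurableSpace G] [BorelSpace G]

/-- The crux's BARE scheme (`c ≡ 1`, `m ≡ 0`; `a, β, L` unchanged). [folklore] -/
def bare (sch : SpeciesScheme (YMSpecies G)) : SpeciesScheme (YMSpecies G) :=
  { sch with c := fun _ _ => 1, m := fun _ _ => 0 }

/-- The crux's `T w k`: BARE truncated plaquette two-point function at the reflected pair `(w, θw)` at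
step `k`. [folklore] -/
def Tbare (r : LatticeRep G) (sch : SpeciesScheme (YMSpecies G)) (w : SchwartzMap E4 ℝ) (k : ℕ) : ℝ :=
  latticeSchwinger r.ρ (bare sch) (fun s => s.F) k (1 + 1) (fun _ => r.curvature) ![w, thetaTest 4 w] -
    latticeSchwinger r.ρ (bare sch) (fun s => s.F) k 1 (fun _ => r.curvature) ![w] *
      latticeSchwinger r.ρ (bare sch) (fun s => s.F) k 1 (fun _ => r.curvature) ![thetaTest 4 w]

/-- The crux's SELF-NORMALISED scheme `canon` (`c'_k = (√T_k(u,θu))⁻¹`, `m'_k = ⟨F⟩_k` on the scheme's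
torus; `a, β, L` unchanged). [folklore] -/
def canon (r : LatticeRep G) (sch : SpeciesScheme (YMSpecies G)) (u : SchwartzMap E4 ℝ) :
    SpeciesScheme (YMSpecies G) :=
  { sch with c := fun _ k => (Real.sqrt (Tbare r sch u k))⁻¹,
             m := fun _ k => ∫ U, r.curvature.F (torusLift (sch.side k) U) ∂(wilsonMeasure r.ρ (sch.β k)) }

/-- The joint third cumulant `κ₃_k(f, g, h)` of the curvature field of the scheme `S` at step `k`
(the crux's conclusion polynomial `S₃ − ΣS₁S₂ + 2S₁S₁S₁`, verbatim; `S = canon r sch u` is the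
self-normalised cumulant, `S = bare sch` the bare one). [folklore] -/
def kappa3 (r : LatticeRep G) (S : SpeciesScheme (YMSpecies G)) (f g h : SchwartzMap E4 ℝ) (k : ℕ) : ℝ :=
  latticeSchwinger r.ρ S (fun s => s.F) k 3 (fun _ => r.curvature) ![f, g, h] -
    latticeSchwinger r.ρ S (fun s => s.F) k 1 (fun _ => r.curvature) ![f] *
      latticeSchwinger r.ρ S (fun s => s.F) k 2 (fun _ => r.curvature) ![g, h] -
    latticeSchwinger r.ρ S (fun s => s.F) k 1 (fun _ => r.curvature) ![g] *
      latticeSchwinger r.ρ S (fun s => s.F) k 2 (fun _ => r.curvature) ![f, h] -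
    latticeSchwinger r.ρ S (fun s => s.F) k 1 (fun _ => r.curvature) ![h] *
      latticeSchwinger r.ρ S (fun s => s.F) k 2 (fun _ => r.curvature) ![f, g] +
    2 * (latticeSchwinger r.ρ S (fun s => s.F) k 1 (fun _ => r.curvature) ![f] *
      latticeSchwinger r.ρ S (fun s => s.F) k 1 (fun _ => r.curvature) ![g] *
      latticeSchwinger r.ρ S (fun s => s.F) k 1 (fun _ => r.curvature) ![h])

/-- The crux's hypothesis block at the datum `(r, sch, u, p, M, Δ)`: weak coupling, `0 < Δ`, the
volume-uniform lattice gap, polynomial volumes, past support of `u`, eventually floor ∧ window at `u`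
(the six hypotheses of W₂ᴳ in order, conjoined). [folklore] -/
def CruxHyps (r : LatticeRep G) (sch : SpeciesScheme (YMSpecies G)) (u : SchwartzMap E4 ℝ) (p : ℕ)
    (M Δ : ℝ) : Prop :=
  sch.HasWeakCouplingLimit ∧ 0 < Δ ∧ HasLatticeMassGap r sch Δ ∧
    (∃ N : ℕ, 1 ≤ N ∧ ∀ᶠ k in Filter.atTop, (sch.a k)⁻¹ ≤ (sch.a k * (sch.L k : ℝ)) ^ N) ∧
      tsupport u ⊆ {y : E4 | y 0 < 0} ∧
        ∀ᶠ k in Filter.atTop, (sch.a k) ^ p ≤ Tbare r sch u k ∧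
          Tbare r sch u k ≤ M * Tbare r sch (timeShiftTest 4 (-1) u) k

end Vocabulary

/-! ## § The three stub STATEMENTS — `def Sig.stub_<name> : Prop`

Named so that the LAST name component of each statement constant is the declared stub's name: the skeleton audit
(`#h21_check_skeleton`) admits a hypothesis of the concluding theorem iff its head is a tagged obligation or its last
name component is a declared stub (`@[stub]` itself is gate-reserved and refused in crux workfiles).  Each
`Sig.stub_<name>` is pinned to the type of `theorem stub_<name>` by the `example`s right after the stubs
(definitional unfolding only). -/

/-- **Statement of stub 1 — the order-3 seam identity** (provable now): for every datum and ALL tests `f, g, h` and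
steps `k`, `κ₃^canon_k(f,g,h) = (√T_k(u,θu))⁻¹ ^ 3 · κ₃⁰_k(f,g,h)`. -/
def Sig.stub_skewSeam : Prop :=
  ∀ (G : Type) [Group G] [TopologicalSpace G] [IsTopologicalGroup G] [CompactSpace G]
      [MeasurableSpace G] [BorelSpace G] (r : LatticeRep G) (sch : SpeciesScheme (YMSpecies G))
      (u f g h : SchwartzMap E4 ℝ) (k : ℕ),
      kappa3 r (canon r sch u) f g h k = (Real.sqrt (Tbare r sch u k))⁻¹ ^ 3 * kappa3 r (bare sch) f g h k

/-- **Statement of stub 2 — canonical-dimension ceiling** of the bare normalisation pair: under the crux hypotheses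
`∃ C, ∀ᶠ k, T_k(u,θu) ≤ C · a_k⁸`. -/
def Sig.stub_twoPointCeiling : Prop :=
  ∀ (G : Type) [Group G] [TopologicalSpace G] [IsTopologicalGroup G] [CompactSpace G]
      [MeasurableSpace G] [BorelSpace G] (r : LatticeRep G) (sch : SpeciesScheme (YMSpecies G))
      (u : SchwartzMap E4 ℝ) (p : ℕ) (M Δ : ℝ), CruxHyps r sch u p M Δ →
      ∃ C : ℝ, ∀ᶠ k in Filter.atTop, Tbare r sch u k ≤ C * (sch.a k) ^ 8

/-- **Statement of stub 3 — slab response floor in the mirror geometry** (the open core): under the crux hypotheses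
there are a slab-supported `g` (`tsupport g ⊆ {|x⁰| < 1}`) and `δ > 0` with eventually
`δ · a_k⁴ · T_k(u,θu) ≤ |κ₃⁰_k(τ₋₁u, g, θτ₋₁u)|`. -/
def Sig.stub_mirrorSlabResponse : Prop :=
  ∀ (G : Type) [Group G] [TopologicalSpace G] [IsTopologicalGroup G] [CompactSpace G]
      [MeasurableSpace G] [BorelSpace G] (r : LatticeRep G) (sch : SpeciesScheme (YMSpecies G))
      (u : SchwartzMap E4 ℝ) (p : ℕ) (M Δ : ℝ), CruxHyps r sch u p M Δ →
      ∃ (g : SchwartzMap E4 ℝ) (δ : ℝ), tsupport g ⊆ {y : E4 | |y 0| < 1} ∧ 0 < δ ∧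
        ∀ᶠ k in Filter.atTop, δ * (sch.a k) ^ 4 * Tbare r sch u k ≤
          |kappa3 r (bare sch) (timeShiftTest 4 (-1) u) g (thetaTest 4 (timeShiftTest 4 (-1) u)) k|

/-! ## § Stubs — the ONLY three `sorry`s of the file (statements restated in full = the registered signatures) -/

/-- **Stub 1 `stub_skewSeam`** (size M, provable now): trilinearity of the joint third cumulant and its
invariance under deterministic shifts of each leg (`wilsonMeasure` is a probability measure,
`isProbabilityMeasure_wilsonMeasure`; the legs are bounded measurable), applied to `Φ^canon = c'·(Φ⁰ − m'·a⁴Σf(a·x))`,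
`c' = (√T)⁻¹` (for `T ≤ 0` both sides vanish).  Order-2 analogue landed: `cov_affine` / `trunc_rescale` /
`smearedLatticeField_affine` (Theorems/ScalingWindowSplitExistenceLegFromLattice). -/
theorem stub_skewSeam :
    ∀ (G : Type) [Group G] [TopologicalSpace G] [IsTopologicalGroup G] [CompactSpace G]
      [MeasurableSpace G] [BorelSpace G] (r : LatticeRep G) (sch : SpeciesScheme (YMSpecies G))
      (u f g h : SchwartzMap E4 ℝ) (k : ℕ),
      kappa3 r (canon r sch u) f g h k = (Real.sqrt (Tbare r sch u k))⁻¹ ^ 3 * kappa3 r (bare sch) f g h k := by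
  sorry

/-- **Stub 2 `stub_twoPointCeiling`** (size L): the bare smeared action density is `a⁴ ×` a field of canonical
dimension 4, so its truncated two-point function at physical separation is `O(a⁸)` uniformly at weak coupling (tree
level `β_k⁻² a_k⁸ I(u)`; at one scale `Z_k² a_k⁸ ⟨θ(u)θ(θu)⟩`, `Z_k → O(1/b₀)`); UV-stability grade (Balaban1985,
MagnenRivasseauSeneor1993, Dimock2013), the class of crux U_R; dual to the floor (forces `p ≥ 8`). -/
theorem stub_twoPointCeiling :
    ∀ (G : Type) [Group G] [TopologicalSpace G] [IsTopologicalGroup G] [CompactSpace G]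
      [MeasurableSpace G] [BorelSpace G] (r : LatticeRep G) (sch : SpeciesScheme (YMSpecies G))
      (u : SchwartzMap E4 ℝ) (p : ℕ) (M Δ : ℝ), CruxHyps r sch u p M Δ →
      ∃ C : ℝ, ∀ᶠ k in Filter.atTop, Tbare r sch u k ≤ C * (sch.a k) ^ 8 := by
  sorry

/-- **Stub 3 `stub_mirrorSlabResponse`** (size XL, OPEN — the load-bearing stub): reflection positivity on the scheme's
odd tori writes `κ₃⁰(Φ⁰(τ₋₁u), Φ⁰(g), Φ⁰(θτ₋₁u))` as a diagonal matrix element of the slab insertion in the window state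
`ψ = e^{-H}Φ̂⁰(u)Ω`; the transfer-matrix Feynman–Hellmann identity / action sum rule (Michael1987; tree
`hasDerivAt_covariance_wilsonMeasure`) evaluates one layer of action density in a level `E_n` as `−∂_β E_n`; the gap
`Δ ≤ m_phys` and dimensional transmutation (`−∂_β log(a m) → 1/(4N b₀) > 0`, MontvayMunster1994 (3.267)) bound the
`1/a_k` layers of the unit slab below by `c_G Δ`; `HasLatticeMassGap` clustering cuts the layer sums down to a Schwartz
slab bump `g`; the window gives `T⁰(τ₋₁u) ≥ T⁰(u)/M`.  Transfer target C⁺ = `GapRunsWithCoupling` (crux idea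
`hellmann-feynman-slab`).  FALSE without the gap (super-weak `U(1)₄`: nothing runs) — this is where the repair
hypothesis is consumed. -/
theorem stub_mirrorSlabResponse :
    ∀ (G : Type) [Group G] [TopologicalSpace G] [IsTopologicalGroup G] [CompactSpace G]
      [MeasurableSpace G] [BorelSpace G] (r : LatticeRep G) (sch : SpeciesScheme (YMSpecies G))
      (u : SchwartzMap E4 ℝ) (p : ℕ) (M Δ : ℝ), CruxHyps r sch u p M Δ →
      ∃ (g : SchwartzMap E4 ℝ) (δ : ℝ), tsupport g ⊆ {y : E4 | |y 0| < 1} ∧ 0 < δ ∧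
        ∀ᶠ k in Filter.atTop, δ * (sch.a k) ^ 4 * Tbare r sch u k ≤
          |kappa3 r (bare sch) (timeShiftTest 4 (-1) u) g (thetaTest 4 (timeShiftTest 4 (-1) u)) k| := by
  sorry

/-! Pins: each `Sig.stub_<name>` IS the type of `stub_<name>` (definitional unfolding only; the converse direction is
exercised by `SelfNormalisedSkewnessGapped_skeleton` below, which feeds the stubs to `_of`). -/

example : Sig.stub_skewSeam := stub_skewSeam
example : Sig.stub_twoPointCeiling := stub_twoPointCeiling
example : Sig.stub_mirrorSlabResponse := stub_mirrorSlabResponse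

/-! ## § Glue — support geometry of the mirror triple (sorry-free) -/

/-- `tsupport (τ_t u) ⊆ (· − t e₀)⁻¹' tsupport u`. -/
theorem tsupport_timeShiftTest_subset (u : SchwartzMap E4 ℝ) (t : ℝ) :
    tsupport (timeShiftTest 4 t u : E4 → ℝ) ⊆
      (fun y : E4 => y - EuclideanSpace.single 0 t) ⁻¹' tsupport (u : E4 → ℝ) := by
  have hfun : (timeShiftTest 4 t u : E4 → ℝ) = fun y => u (y - EuclideanSpace.single 0 t) :=
    funext fun y => timeShiftTest_apply 4 t u y
  rw [hfun]
  exact tsupport_schwartz_comp_subset u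
    (continuous_id.sub continuous_const : Continuous fun y : E4 => y - EuclideanSpace.single 0 t)

/-- `tsupport (Θ w) ⊆ θ⁻¹' tsupport w`. -/
theorem tsupport_thetaTest_subset (w : SchwartzMap E4 ℝ) :
    tsupport (thetaTest 4 w : E4 → ℝ) ⊆ (timeReflection 4) ⁻¹' tsupport (w : E4 → ℝ) := by
  have hfun : (thetaTest 4 w : E4 → ℝ) = fun y => w (timeReflection 4 y) :=
    funext fun y => thetaTest_apply 4 w y
  rw [hfun]
  exact tsupport_schwartz_comp_subset w (timeReflection 4).continuous

/-- Past support moves one unit further into the past under `τ₋₁`: `tsupport τ₋₁u ⊆ {x⁰ < −1}`. -/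
theorem tsupport_pastShift_subset {u : SchwartzMap E4 ℝ} (hu : tsupport (u : E4 → ℝ) ⊆ {y : E4 | y 0 < 0}) :
    tsupport (timeShiftTest 4 (-1) u : E4 → ℝ) ⊆ {y : E4 | y 0 < -1} := by
  intro y hy
  have h := hu (tsupport_timeShiftTest_subset u (-1) hy)
  have h' : y 0 - (-1) < 0 := by
    have := h
    simp only [Set.mem_setOf_eq] at this
    simpa [PiLp.single_apply] using this
  simp only [Set.mem_setOf_eq]
  linarith

/-- The mirror image of the shifted bump lives in the future: `tsupport θτ₋₁u ⊆ {1 < x⁰}`. -/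
theorem tsupport_mirror_subset {u : SchwartzMap E4 ℝ} (hu : tsupport (u : E4 → ℝ) ⊆ {y : E4 | y 0 < 0}) :
    tsupport (thetaTest 4 (timeShiftTest 4 (-1) u) : E4 → ℝ) ⊆ {y : E4 | 1 < y 0} := by
  intro y hy
  have h := tsupport_pastShift_subset hu (tsupport_thetaTest_subset _ hy)
  simp only [Set.mem_setOf_eq, timeReflection_apply] at h
  simp only [Set.mem_setOf_eq]
  simp at h
  linarith

/-! ## § Glue — the let-free form of the crux and the assembly (sorry-free) -/

/-- The crux with its three `let`s delta/zeta-unfolded into the vocabulary above (curried, binder for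
binder); `cruxLetFree_iff` certifies it IS the route decl by `Iff.rfl`. -/
def CruxLetFree : Prop :=
  ∀ (G : Type) [Group G] [TopologicalSpace G] [IsTopologicalGroup G] [CompactSpace G]
    [MeasurableSpace G] [BorelSpace G] (r : LatticeRep G) (sch : SpeciesScheme (YMSpecies G))
    (u : SchwartzMap E4 ℝ) (p : ℕ) (M Δ : ℝ),
    sch.HasWeakCouplingLimit → 0 < Δ → HasLatticeMassGap r sch Δ →
      (∃ N : ℕ, 1 ≤ N ∧ ∀ᶠ k in Filter.atTop, (sch.a k)⁻¹ ≤ (sch.a k * (sch.L k : ℝ)) ^ N) →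
        tsupport u ⊆ {y : E4 | y 0 < 0} →
          (∀ᶠ k in Filter.atTop, (sch.a k) ^ p ≤ Tbare r sch u k ∧
            Tbare r sch u k ≤ M * Tbare r sch (timeShiftTest 4 (-1) u) k) →
            ∃ (f g h : SchwartzMap E4 ℝ) (δ : ℝ), Disjoint (tsupport f) (tsupport g) ∧
              Disjoint (tsupport f) (tsupport h) ∧ Disjoint (tsupport g) (tsupport h) ∧ 0 < δ ∧
                ∀ᶠ k in Filter.atTop, δ ≤ |kappa3 r (canon r sch u) f g h k|

/-- The let-free form IS the route decl (definitional unfolding only). -/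
theorem cruxLetFree_iff :
    CruxLetFree ↔ Summit.QuantumFields.YangMills.Theses.ScalingWindowSplit.SelfNormalisedSkewnessGapped :=
  Iff.rfl

/-- **Assembly on the let-free form**: seam ∧ ceiling ∧ slab response ⇒ the crux, by the floor
(`T > 0`) and square-root arithmetic `|κ₃^canon| = (√T)⁻³|κ₃⁰| ≥ δ a⁴/√T ≥ δ/√(max C 1)`. -/
theorem cruxLetFree_of (hSeam : Sig.stub_skewSeam) (hCeil : Sig.stub_twoPointCeiling)
    (hSlab : Sig.stub_mirrorSlabResponse) : CruxLetFree := by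
  intro G _ _ _ _ _ _ r sch u p M Δ hw hΔ hgap hpv hu hfw
  have hH : CruxHyps r sch u p M Δ := ⟨hw, hΔ, hgap, hpv, hu, hfw⟩
  obtain ⟨C, hC⟩ := hCeil G r sch u p M Δ hH
  obtain ⟨g, δ, hg, hδ, hslab⟩ := hSlab G r sch u p M Δ hH
  have hf := tsupport_pastShift_subset hu
  have hh := tsupport_mirror_subset hu
  have hC' : 0 < max C 1 := lt_of_lt_of_le one_pos (le_max_right C 1)
  have hsC : 0 < Real.sqrt (max C 1) := Real.sqrt_pos.2 hC'
  refine ⟨timeShiftTest 4 (-1) u, g, thetaTest 4 (timeShiftTest 4 (-1) u), δ / Real.sqrt (max C 1),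
    ?_, ?_, ?_, div_pos hδ hsC, ?_⟩
  · -- past leg vs slab
    refine Set.disjoint_left.2 fun y hyf hyg => ?_
    have h1 : y 0 < -1 := hf hyf
    have h2 : |y 0| < 1 := hg hyg
    have h3 := neg_abs_le (y 0)
    linarith
  · -- past leg vs its mirror
    refine Set.disjoint_left.2 fun y hyf hyh => ?_
    have h1 : y 0 < -1 := hf hyf
    have h2 : 1 < y 0 := hh hyh
    linarith
  · -- slab vs mirror
    refine Set.disjoint_left.2 fun y hyg hyh => ?_
    have h1 : |y 0| < 1 := hg hyg
    have h2 : 1 < y 0 := hh hyh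
    have h3 := le_abs_self (y 0)
    linarith
  · filter_upwards [hfw, hC, hslab] with k hk hCk hSk
    have ha : 0 < sch.a k := sch.a_pos k
    have hT : 0 < Tbare r sch u k := lt_of_lt_of_le (pow_pos ha p) hk.1
    -- the seam, in absolute value
    rw [hSeam G r sch u (timeShiftTest 4 (-1) u) g (thetaTest 4 (timeShiftTest 4 (-1) u)) k, abs_mul]
    -- generalize the square root
    obtain ⟨s, hs_def⟩ : ∃ s : ℝ, Real.sqrt (Tbare r sch u k) = s := ⟨_, rfl⟩
    have hs : 0 < s := hs_def ▸ Real.sqrt_pos.2 hT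
    have hsT : s ^ 2 = Tbare r sch u k := by rw [← hs_def]; exact Real.sq_sqrt hT.le
    -- ceiling in square-root form: s ≤ √(max C 1) · a⁴
    have hTC : Tbare r sch u k ≤ max C 1 * (sch.a k) ^ 8 :=
      hCk.trans (mul_le_mul_of_nonneg_right (le_max_left C 1) (pow_nonneg ha.le 8))
    have hsqrt : s ≤ Real.sqrt (max C 1) * (sch.a k) ^ 4 := by
      have h8 : (sch.a k) ^ 8 = ((sch.a k) ^ 4) ^ 2 := by ring
      calc s = Real.sqrt (Tbare r sch u k) := hs_def.symm
        _ ≤ Real.sqrt (max C 1 * (sch.a k) ^ 8) := Real.sqrt_le_sqrt hTC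
        _ = Real.sqrt (max C 1) * Real.sqrt ((sch.a k) ^ 8) := Real.sqrt_mul hC'.le _
        _ = Real.sqrt (max C 1) * (sch.a k) ^ 4 := by rw [h8, Real.sqrt_sq (pow_nonneg ha.le 4)]
    rw [hs_def]
    have hs3 : 0 < s⁻¹ ^ 3 := pow_pos (inv_pos.2 hs) 3
    rw [abs_of_pos hs3]
    -- step 1: δ a⁴ / s ≤ s⁻¹³ |κ⁰|
    have step1 : δ * (sch.a k) ^ 4 / s ≤
        s⁻¹ ^ 3 * |kappa3 r (bare sch) (timeShiftTest 4 (-1) u) g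
          (thetaTest 4 (timeShiftTest 4 (-1) u)) k| := by
      have hmul := mul_le_mul_of_nonneg_left hSk hs3.le
      have heq : s⁻¹ ^ 3 * (δ * (sch.a k) ^ 4 * Tbare r sch u k) = δ * (sch.a k) ^ 4 / s := by
        rw [← hsT]
        field_simp
      rw [heq] at hmul
      exact hmul
    -- step 2: δ / √(max C 1) ≤ δ a⁴ / s
    have step2 : δ / Real.sqrt (max C 1) ≤ δ * (sch.a k) ^ 4 / s := by
      rw [div_le_div_iff₀ hsC hs]
      calc δ * s ≤ δ * (Real.sqrt (max C 1) * (sch.a k) ^ 4) := mul_le_mul_of_nonneg_left hsqrt hδ.le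
        _ = δ * (sch.a k) ^ 4 * Real.sqrt (max C 1) := by ring
    exact step2.trans step1

/-- **`SelfNormalisedSkewnessGapped_of` — the kernel-checked composition**: the three stub statements imply the
crux BY NAME (sorry-free; axioms `propext`, `Classical.choice`, `Quot.sound`). -/
theorem SelfNormalisedSkewnessGapped_of :
    Sig.stub_skewSeam → Sig.stub_twoPointCeiling → Sig.stub_mirrorSlabResponse →
      Summit.QuantumFields.YangMills.Theses.ScalingWindowSplit.SelfNormalisedSkewnessGapped :=
  fun h₁ h₂ h₃ => cruxLetFree_iff.1 (cruxLetFree_of h₁ h₂ h₃)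

/-- The skeleton instantiated with the three stubs BY NAME (closed modulo exactly the stubs' `sorry`s). -/
theorem SelfNormalisedSkewnessGapped_skeleton :
    Summit.QuantumFields.YangMills.Theses.ScalingWindowSplit.SelfNormalisedSkewnessGapped :=
  SelfNormalisedSkewnessGapped_of stub_skewSeam stub_twoPointCeiling stub_mirrorSlabResponse

end Summit.QuantumFields.YangMills.Cruxes.SelfNormalisedSkewnessGapped.Birth

end
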